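import Literature.NumberTheory.Automorphic.LcIntegral
import Literature.NumberTheory.Automorphic.MatrixCoefficients
import Literature.NumberTheory.Automorphic.RestrictedTensorProductIrreducibleProofs
import Literature.NumberTheory.Automorphic.SmoothRepresentationIrreducibleContragredientProofs
import Literature.NumberTheory.Automorphic.AdmissibleSubquotient
import Mathlib.Analysis.Complex.Polynomial.Basic
import HarnessLib

/-!
# Compact irreducible representations are projective (finite-sum Schur theory)

Let `G` be a topological group with a compact open subgroup `K₀` and compact centre, and let
`κ` be an irreducible admissible representation of `G` over `ℂ` whose smooth matrix coefficients
are compactly supported modulo the centre (`Representation.IsSupercuspidal`; with compact centre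
this means compactly supported: a *compact* representation in the sense of
Bernstein–Zelevinsky 1976, §2.40). We prove that **`κ` is a projective object among smooth
representations**: every surjective intertwining map `σ ↠ κ` from a smooth representation `σ`
admits an equivariant section (`Representation.exists_section_of_isSupercuspidal`). This is
Bernstein–Zelevinsky 1976, Thm. 2.44 (b)/(c) ("finitely generated compact representations are
projective"; cf. Bernstein–Zelevinsky 1977, Thm. 2.4 (a)–(b), Casselman 1995, Thm. 5.4.1), in
the irreducible case, with a measure-free proof:

* the functions `h ↦ λ(κ(h⁻¹) v)`, `λ ∈ Ṽ` smooth, are right-invariant under the stabiliser of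
  `λ` and compactly supported, so `S_{λ,y}(v) = ∫ λ(κ(h⁻¹) v) σ(h) y dh` is a finite sum
  (`LcIntegral`); it is linear and **equivariant in `v`** by left invariance of the integral
  (`Representation.compactLift`), and natural in `σ`;
* for `σ = κ`, `S_{λ,v₀}` is an intertwiner `κ → κ`, hence a scalar `c` (Schur's lemma for
  admissible irreducibles, `Representation.IsAdmissible.exists_eq_smul_id`);
* `c ≠ 0` for a suitable `λ`: with the invariant Hermitian form
  `B(v, w) = ∫ λ₁(κ(h⁻¹) v) conj(λ₁(κ(h⁻¹) w)) dh` (`Representation.compactForm`, invariant by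
  left invariance, `B(v,v) ≥ 0` termwise) and `λ = B(·, v₀)`, one gets
  `λ(S_{λ,v₀} v₀) = ∫ |B(κ(h) v₀, v₀)|² dh > 0`;
* given `q : σ ↠ κ` and `y` with `q y = v₀`, `v ↦ c⁻¹ S_{λ,y}(v)` is the section.

Only left invariance of the integral is used (no unimodularity). Definitions `coeffFun`,
`compactForm`, `compactLift` (auxiliary) and theorems; no named facts.

## References

* I. N. Bernstein, A. V. Zelevinsky, *Representations of the group `GL(n, F)` where `F` is a
  non-archimedean local field*, Russian Math. Surveys 31:3 (1976), §2.40–2.44.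
* I. N. Bernstein, A. V. Zelevinsky, *Induced representations of reductive `p`-adic groups I*,
  Ann. Sci. ÉNS 10 (1977), Thm. 2.4, p. 447.
* W. Casselman, *Introduction to the theory of admissible representations of `p`-adic reductive
  groups* (1995 notes), §5.2–5.4.
-/

noncomputable section

open scoped Pointwise ComplexConjugate

namespace Representation

open Literature.NumberTheory.Automorphic Literature.NumberTheory.Automorphic.LcIntegral

section Coefficients

variable {G V : Type*} [Group G] [AddCommGroup V] [Module ℂ V] (κ : Representation ℂ G V)

/-- The **coefficient function** `h ↦ λ(κ(h⁻¹) v)` attached to a linear form `λ` and a vector `v`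
(the matrix coefficient `c_{λ,v}` composed with inversion). [folklore] -/
def coeffFun (lam : Module.Dual ℂ V) (v : V) : G → ℂ := fun h => lam (κ h⁻¹ v)

/-- Unfolding lemma for `coeffFun`. [folklore] -/
@[simp] theorem coeffFun_apply (lam : Module.Dual ℂ V) (v : V) (h : G) :
    κ.coeffFun lam v h = lam (κ h⁻¹ v) := rfl

/-- `coeffFun` is right-invariant under the stabiliser of `λ` in the dual representation:
`λ(κ((h k)⁻¹) v) = (κ^*(k) λ)(κ(h⁻¹) v)`. [folklore] -/
theorem coeffFun_mul_of_mem_stabilizer (lam : Module.Dual ℂ V) (v : V) (h k : G)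
    (hk : k ∈ κ.dual.stabilizerSubgroup lam) : κ.coeffFun lam v (h * k) = κ.coeffFun lam v h := by
  rw [mem_stabilizerSubgroup] at hk
  rw [coeffFun_apply, coeffFun_apply, mul_inv_rev, map_mul, Module.End.mul_apply]
  conv_rhs => rw [← hk]
  rw [dual_apply, Module.Dual.transpose_apply, LinearMap.comp_apply]

/-- `coeffFun` is linear in the vector. [folklore] -/
theorem coeffFun_add (lam : Module.Dual ℂ V) (v w : V) :
    κ.coeffFun lam (v + w) = κ.coeffFun lam v + κ.coeffFun lam w := by
  funext h; simp

/-- `coeffFun` is homogeneous in the vector. [folklore] -/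
theorem coeffFun_smul (lam : Module.Dual ℂ V) (c : ℂ) (v : V) :
    κ.coeffFun lam (c • v) = c • κ.coeffFun lam v := by
  funext h; simp

/-- Translating the vector translates the coefficient function on the left:
`coeffFun λ (κ g v) h = coeffFun λ v (g⁻¹ h)`. [folklore] -/
theorem coeffFun_apply_apply (lam : Module.Dual ℂ V) (v : V) (g h : G) :
    κ.coeffFun lam (κ g v) h = κ.coeffFun lam v (g⁻¹ * h) := by
  simp [mul_inv_rev, Module.End.mul_apply]

variable [TopologicalSpace G] [IsTopologicalGroup G]

/-- **Compact support of the coefficient functions.** If the smooth matrix coefficients of `κ`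
are compactly supported modulo the centre (`IsSupercuspidal`) and the centre is compact, then for
`λ ∈ Ṽ` and `v ∈ V` the function `h ↦ λ(κ(h⁻¹) v)` vanishes off a compact set. [folklore] -/
theorem exists_isCompact_coeffFun (hsc : κ.IsSupercuspidal) (hZ : IsCompact (Subgroup.center G : Set G))
    {lam : Module.Dual ℂ V} (hlam : lam ∈ κ.contragredient) (v : V) :
    ∃ C : Set G, IsCompact C ∧ ∀ h, κ.coeffFun lam v h ≠ 0 → h ∈ C := by
  obtain ⟨C, hC, hsupp⟩ := hsc lam hlam v
  refine ⟨(C * (Subgroup.center G : Set G))⁻¹, (hC.mul hZ).inv, fun h hh => ?_⟩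
  rw [Set.mem_inv]
  exact hsupp (by simpa [matrixCoeff] using hh)

variable (K₀ : Subgroup G)

/-- The natural level of the coefficient functions of `λ`: `K₀ ∩ Stab_{κ^*}(λ)`. [folklore] -/
def coeffLevel (lam : Module.Dual ℂ V) : Subgroup G := K₀ ⊓ κ.dual.stabilizerSubgroup lam

/-- The coefficient functions `h ↦ λ(κ(h⁻¹) v) • y`-type integrands are adapted to the level
`K₀ ∩ Stab(λ) ∩ L` for every open `L` fixing the second factor: the basic adaptedness lemma. Here
in the scalar form: `h ↦ λ(κ(h⁻¹) v) * ψ h` is adapted to `K₀ ∩ Stab(λ) ∩ L` whenever `ψ` is right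
`L`-invariant, `L` open. [folklore] -/
theorem isAdapted_coeffFun_mul (hK₀o : IsOpen (K₀ : Set G)) (hK₀c : IsCompact (K₀ : Set G))
    (hsc : κ.IsSupercuspidal) (hZ : IsCompact (Subgroup.center G : Set G))
    {lam : Module.Dual ℂ V} (hlam : lam ∈ κ.contragredient) (v : V)
    {Y : Type*} [AddCommGroup Y] [Module ℂ Y] {L : Subgroup G} (hL : IsOpen (L : Set G))
    {ψ : G → Y} (hψ : ∀ (g l : G), l ∈ L → ψ (g * l) = ψ g) :
    IsAdapted K₀ (κ.coeffLevel K₀ lam ⊓ L) fun h => κ.coeffFun lam v h • ψ h := by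
  obtain ⟨C, hC, hsupp⟩ := κ.exists_isCompact_coeffFun hsc hZ hlam v
  refine isAdapted_of_isCompact (inf_le_left.trans inf_le_left) ?_ hK₀c ?_ hC ?_
  · exact (hK₀o.inter hlam).inter hL
  · intro g l hl
    rw [κ.coeffFun_mul_of_mem_stabilizer lam v g l hl.1.2, hψ g l hl.2]
  · intro h hh
    by_contra hC'
    have : κ.coeffFun lam v h = 0 := by
      by_contra h0
      exact hC' (hsupp h h0)
    exact hh (by rw [this, zero_smul])

end Coefficients

/-! ### Complex conjugation and the integral -/

section Conj

variable {G : Type*} [Group G] {K₀ K : Subgroup G} {φ : G → ℂ}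

/-- Complex conjugation commutes with the finite-sum integral. [folklore] -/
theorem conj_lcInt (h : IsAdapted K₀ K φ) :
    conj (lcInt (k := ℂ) K₀ K φ) = lcInt (k := ℂ) K₀ K fun g => conj (φ g) := by
  rw [lcInt, lcInt, smul_eq_mul, smul_eq_mul, map_mul, map_inv₀, map_natCast]
  congr 1
  exact AddMonoidHom.map_finsum (starRingEnd ℂ).toAddMonoidHom h.finite

end Conj

/-! ### The invariant Hermitian form -/

section Form

variable {G V : Type*} [Group G] [TopologicalSpace G] [IsTopologicalGroup G]
  [AddCommGroup V] [Module ℂ V] (κ : Representation ℂ G V) (K₀ : Subgroup G) (lam₁ : Module.Dual ℂ V)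

/-- The integrand of the form: `h ↦ λ₁(κ(h⁻¹) v) · conj λ₁(κ(h⁻¹) w)`. [folklore] -/
def formFun (v w : V) : G → ℂ := fun h => κ.coeffFun lam₁ v h * conj (κ.coeffFun lam₁ w h)

/-- The level of the form: `K₀ ∩ Stab(λ₁)` (written `coeffLevel ⊓ Stab(λ₁)`). [folklore] -/
def formLevel : Subgroup G := κ.coeffLevel K₀ lam₁ ⊓ κ.dual.stabilizerSubgroup lam₁

/-- The **averaged Hermitian form** `B(v, w) = ∫ λ₁(κ(h⁻¹) v) conj(λ₁(κ(h⁻¹) w)) dh` of a compact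
representation (finite-sum integral, `LcIntegral.lcInt`). (Bernstein–Zelevinsky 1976, §2.40–2.42;
Casselman 1995, §5.2: compact representations are unitarisable.) [folklore] -/
def compactForm (v w : V) : ℂ := lcInt (k := ℂ) K₀ (κ.formLevel K₀ lam₁) (κ.formFun lam₁ v w)

variable {κ K₀ lam₁}
variable (hK₀o : IsOpen (K₀ : Set G)) (hK₀c : IsCompact (K₀ : Set G)) (hsc : κ.IsSupercuspidal)
  (hZ : IsCompact (Subgroup.center G : Set G)) (hlam₁ : lam₁ ∈ κ.contragredient)

include hK₀o hK₀c hsc hZ hlam₁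

/-- The integrand of the form is adapted to the level `K₀ ∩ Stab(λ₁)`. [folklore] -/
theorem isAdapted_formFun (v w : V) : IsAdapted K₀ (κ.formLevel K₀ lam₁) (κ.formFun lam₁ v w) :=
  κ.isAdapted_coeffFun_mul K₀ hK₀o hK₀c hsc hZ hlam₁ v hlam₁ (ψ := fun h => conj (κ.coeffFun lam₁ w h))
    fun g l hl => by rw [κ.coeffFun_mul_of_mem_stabilizer lam₁ w g l hl]

/-- `B` is additive in the first variable. [folklore] -/
theorem compactForm_add_left (v v' w : V) :
    κ.compactForm K₀ lam₁ (v + v') w = κ.compactForm K₀ lam₁ v w + κ.compactForm K₀ lam₁ v' w := by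
  rw [compactForm, compactForm, compactForm,
    ← (isAdapted_formFun hK₀o hK₀c hsc hZ hlam₁ v w).lcInt_add (isAdapted_formFun hK₀o hK₀c hsc hZ hlam₁ v' w)]
  congr 1
  funext h
  simp [formFun, add_mul]

/-- `B` is homogeneous in the first variable. [folklore] -/
theorem compactForm_smul_left (c : ℂ) (v w : V) :
    κ.compactForm K₀ lam₁ (c • v) w = c * κ.compactForm K₀ lam₁ v w := by
  rw [compactForm, compactForm, ← smul_eq_mul, ← (isAdapted_formFun hK₀o hK₀c hsc hZ hlam₁ v w).lcInt_smul c]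
  congr 1
  funext h
  simp [formFun, mul_assoc]

/-- `B` is Hermitian: `B(w, v) = conj B(v, w)`. [folklore] -/
theorem compactForm_conj_symm (v w : V) :
    κ.compactForm K₀ lam₁ w v = conj (κ.compactForm K₀ lam₁ v w) := by
  rw [compactForm, compactForm, conj_lcInt (isAdapted_formFun hK₀o hK₀c hsc hZ hlam₁ v w)]
  congr 1
  funext h
  simp [formFun, mul_comm]

/-- **Invariance of `B`**: `B(κ(g) v, κ(g) w) = B(v, w)` (left invariance of the integral).
[folklore] -/
theorem compactForm_apply_apply (g : G) (v w : V) :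
    κ.compactForm K₀ lam₁ (κ g v) (κ g w) = κ.compactForm K₀ lam₁ v w := by
  rw [compactForm, compactForm, ← (isAdapted_formFun hK₀o hK₀c hsc hZ hlam₁ v w).lcInt_comp_mul_left g⁻¹]
  congr 1
  funext h
  simp only [formFun, coeffFun_apply_apply]

omit [TopologicalSpace G] [IsTopologicalGroup G] hK₀o hK₀c hsc hZ hlam₁ in
/-- The diagonal values `B(v, v)` are integrals of `|λ₁(κ(h⁻¹) v)|²`. [folklore] -/
theorem formFun_self (v : V) (h : G) :
    κ.formFun lam₁ v v h = (Complex.normSq (κ.coeffFun lam₁ v h) : ℂ) := by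
  rw [formFun, Complex.mul_conj]

omit hK₀o hK₀c hsc hZ hlam₁ in
/-- **Positivity of `B`**: if `λ₁ v ≠ 0` then `B(v, v) ≠ 0` (indeed `> 0`): the integrand
`|λ₁(κ(h⁻¹) v)|²` is non-negative and equals `|λ₁ v|² > 0` at `h = 1`. [folklore] -/
theorem compactForm_self_ne_zero (hK₀o : IsOpen (K₀ : Set G)) (hK₀c : IsCompact (K₀ : Set G))
    (hsc : κ.IsSupercuspidal) (hZ : IsCompact (Subgroup.center G : Set G))
    (hlam₁ : lam₁ ∈ κ.contragredient) {v : V} (hv : lam₁ v ≠ 0) : κ.compactForm K₀ lam₁ v v ≠ 0 := by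
  refine (isAdapted_formFun hK₀o hK₀c hsc hZ hlam₁ v v).lcInt_ne_zero (fun g => ?_) (fun g => ?_) ?_
  · rw [formFun_self, Complex.ofReal_re]
    exact Complex.normSq_nonneg _
  · rw [formFun_self, Complex.ofReal_im]
  · rw [formFun_self, Ne, Complex.ofReal_eq_zero, Complex.normSq_eq_zero, coeffFun_apply,
      inv_one, map_one]
    exact hv

/-- **The smooth functional `B(·, v₀)`**: linear in the first variable and fixed by the
stabiliser of `v₀` under the dual action (`(κ^*(g) B(·, v₀))(v) = B(κ(g⁻¹) v, v₀) = B(v, κ(g) v₀)`),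
hence a vector of the contragredient `Ṽ`. [folklore] -/
def formDual (v₀ : V) : Module.Dual ℂ V where
  toFun v := κ.compactForm K₀ lam₁ v v₀
  map_add' v v' := compactForm_add_left hK₀o hK₀c hsc hZ hlam₁ v v' v₀
  map_smul' c v := compactForm_smul_left hK₀o hK₀c hsc hZ hlam₁ c v v₀

/-- Unfolding lemma for `formDual`. [folklore] -/
@[simp] theorem formDual_apply (v₀ v : V) : formDual hK₀o hK₀c hsc hZ hlam₁ v₀ v = κ.compactForm K₀ lam₁ v v₀ := rfl

/-- The dual action on `B(·, v₀)`: `κ^*(g) B(·, v₀) = B(·, κ(g) v₀)`. [folklore] -/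
theorem dual_formDual (g : G) (v₀ : V) :
    κ.dual g (formDual hK₀o hK₀c hsc hZ hlam₁ v₀) = formDual hK₀o hK₀c hsc hZ hlam₁ (κ g v₀) := by
  ext v
  simp only [dual_apply, Module.Dual.transpose_apply, LinearMap.comp_apply, formDual_apply]
  rw [← compactForm_apply_apply hK₀o hK₀c hsc hZ hlam₁ g (κ g⁻¹ v) v₀, ← Module.End.mul_apply, ← map_mul,
    mul_inv_cancel, map_one, Module.End.one_apply]

/-- `B(·, v₀)` lies in the contragredient when `κ` is smooth. [folklore] -/
theorem formDual_mem_contragredient (hκ : κ.IsSmooth) (v₀ : V) :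
    formDual hK₀o hK₀c hsc hZ hlam₁ v₀ ∈ κ.contragredient := by
  refine κ.dual.isSmoothVector_of_le (hκ v₀) fun g hg => ?_
  rw [mem_stabilizerSubgroup] at hg ⊢
  rw [dual_formDual hK₀o hK₀c hsc hZ hlam₁, hg]

end Form

/-! ### The equivariant lift `S_{λ,y}(v) = ∫ λ(κ(h⁻¹) v) σ(h) y dh` -/

section Lift

variable {G V Y : Type*} [Group G] [TopologicalSpace G] [IsTopologicalGroup G]
  [AddCommGroup V] [Module ℂ V] [AddCommGroup Y] [Module ℂ Y]
  (κ : Representation ℂ G V) (K₀ : Subgroup G) (lam : Module.Dual ℂ V) (σ : Representation ℂ G Y)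

/-- The integrand of the lift: `h ↦ λ(κ(h⁻¹) v) • σ(h) y`. [folklore] -/
def liftFun (v : V) (y : Y) : G → Y := fun h => κ.coeffFun lam v h • σ h y

/-- The level of the lift: `K₀ ∩ Stab(λ) ∩ Stab_σ(y)`. [folklore] -/
def liftLevel (y : Y) : Subgroup G := κ.coeffLevel K₀ lam ⊓ σ.stabilizerSubgroup y

/-- The **equivariant lift** `S_{λ,y}(v) = ∫ λ(κ(h⁻¹) v) σ(h) y dh ∈ Y` attached to a smooth
functional `λ` of the compact representation `κ` and a smooth vector `y` of `σ` (finite-sum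
integral). (Bernstein–Zelevinsky 1976, §2.42–2.44: the operators built from matrix coefficients of
a compact representation.) [folklore] -/
def compactLift (y : Y) (v : V) : Y := lcInt (k := ℂ) K₀ (liftLevel κ K₀ lam σ y) (liftFun κ lam σ v y)

variable {κ K₀ lam σ}
variable (hK₀o : IsOpen (K₀ : Set G)) (hK₀c : IsCompact (K₀ : Set G)) (hsc : κ.IsSupercuspidal)
  (hZ : IsCompact (Subgroup.center G : Set G)) (hlam : lam ∈ κ.contragredient)

include hK₀o hK₀c hsc hZ hlam

/-- The integrand of the lift is adapted to `K₀ ∩ Stab(λ) ∩ L` for every open subgroup `L` fixing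
`y`. [folklore] -/
theorem isAdapted_liftFun {L : Subgroup G} (hL : IsOpen (L : Set G)) {y : Y} (hy : ∀ l ∈ L, σ l y = y)
    (v : V) : IsAdapted K₀ (κ.coeffLevel K₀ lam ⊓ L) (liftFun κ lam σ v y) :=
  κ.isAdapted_coeffFun_mul K₀ hK₀o hK₀c hsc hZ hlam v hL (ψ := fun h => σ h y) fun g l hl => by
    rw [map_mul, Module.End.mul_apply, hy l hl]

/-- The integrand of the lift is adapted to its level when `y` is a smooth vector. [folklore] -/
theorem isAdapted_liftFun_liftLevel {y : Y} (hy : σ.IsSmoothVector y) (v : V) :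
    IsAdapted K₀ (liftLevel κ K₀ lam σ y) (liftFun κ lam σ v y) :=
  isAdapted_liftFun hK₀o hK₀c hsc hZ hlam hy (fun _ hl => hl) v

/-- The lift is additive in `v`. [folklore] -/
theorem compactLift_add {y : Y} (hy : σ.IsSmoothVector y) (v v' : V) :
    compactLift κ K₀ lam σ y (v + v') = compactLift κ K₀ lam σ y v + compactLift κ K₀ lam σ y v' := by
  rw [compactLift, compactLift, compactLift, ← (isAdapted_liftFun_liftLevel hK₀o hK₀c hsc hZ hlam hy v).lcInt_add
    (isAdapted_liftFun_liftLevel hK₀o hK₀c hsc hZ hlam hy v')]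
  congr 1
  funext h
  simp [liftFun, add_smul]

/-- The lift is homogeneous in `v`. [folklore] -/
theorem compactLift_smul {y : Y} (hy : σ.IsSmoothVector y) (c : ℂ) (v : V) :
    compactLift κ K₀ lam σ y (c • v) = c • compactLift κ K₀ lam σ y v := by
  rw [compactLift, compactLift, ← (isAdapted_liftFun_liftLevel hK₀o hK₀c hsc hZ hlam hy v).lcInt_smul c]
  congr 1
  funext h
  simp [liftFun, mul_smul]

/-- **Equivariance of the lift**: `S(κ(g) v) = σ(g) S(v)` (left invariance of the integral).
[folklore] -/
theorem compactLift_apply {y : Y} (hy : σ.IsSmoothVector y) (g : G) (v : V) :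
    compactLift κ K₀ lam σ y (κ g v) = σ g (compactLift κ K₀ lam σ y v) := by
  have had := isAdapted_liftFun_liftLevel hK₀o hK₀c hsc hZ hlam hy (κ g v)
  rw [compactLift, compactLift, (isAdapted_liftFun_liftLevel hK₀o hK₀c hsc hZ hlam hy v).map_lcInt (σ g),
    ← had.lcInt_comp_mul_left g]
  congr 1
  funext h
  simp only [liftFun, Function.comp_apply, coeffFun_apply_apply, map_smul, inv_mul_cancel_left, map_mul,
    Module.End.mul_apply]

/-- **Naturality of the lift** in `σ`: for an intertwining map `T : σ → σ'` and a smooth vector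
`y`, `T (S_y v) = S_{T y} v`. [folklore] -/
theorem map_compactLift {Y' : Type*} [AddCommGroup Y'] [Module ℂ Y'] {σ' : Representation ℂ G Y'}
    (T : σ.IntertwiningMap σ') {y : Y} (hy : σ.IsSmoothVector y) (v : V) :
    T (compactLift κ K₀ lam σ y v) = compactLift κ K₀ lam σ' (T y) v := by
  have h1 := isAdapted_liftFun_liftLevel hK₀o hK₀c hsc hZ hlam hy v
  -- `liftFun σ' v (T y)` is adapted to the level of `y` as well as to its own level
  have h2 : IsAdapted K₀ (liftLevel κ K₀ lam σ y) (liftFun κ lam σ' v (T y)) :=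
    isAdapted_liftFun hK₀o hK₀c hsc hZ hlam hy (fun l hl => by
      rw [← T.isIntertwining, (σ.mem_stabilizerSubgroup y l).1 hl]) v
  have h3 : IsAdapted K₀ (liftLevel κ K₀ lam σ' (T y)) (liftFun κ lam σ' v (T y)) :=
    isAdapted_liftFun_liftLevel hK₀o hK₀c hsc hZ hlam (IsSmoothVector.map T hy) v
  rw [compactLift, compactLift, ← IntertwiningMap.toLinearMap_apply, h1.map_lcInt T.toLinearMap, ← h2.lcInt_eq h3]
  congr 1
  funext h
  simp only [liftFun, Function.comp_apply, IntertwiningMap.coe_toLinearMap, map_smul]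
  rw [T.isIntertwining]

end Lift

/-! ### Schur scalar, positivity, projectivity -/

section Projective

variable {G V : Type*} [Group G] [TopologicalSpace G] [IsTopologicalGroup G]
  [AddCommGroup V] [Module ℂ V] {κ : Representation ℂ G V} {K₀ : Subgroup G}
  (hK₀o : IsOpen (K₀ : Set G)) (hK₀c : IsCompact (K₀ : Set G)) (hsc : κ.IsSupercuspidal)
  (hZ : IsCompact (Subgroup.center G : Set G)) (hκ : κ.IsAdmissible)

include hK₀o hK₀c hsc hZ hκ

/-- **The Schur scalar.** For `λ ∈ Ṽ` and `v₀ ∈ V`, the lift `S_{λ,v₀} : κ → κ` (with `σ = κ`) is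
an intertwiner, hence a scalar `c` when `κ` is irreducible admissible. [folklore] -/
theorem exists_compactLift_self_eq_smul [κ.IsIrreducible] {lam : Module.Dual ℂ V}
    (hlam : lam ∈ κ.contragredient) (v₀ : V) :
    ∃ c : ℂ, ∀ v, compactLift κ K₀ lam κ v₀ v = c • v := by
  have hy : κ.IsSmoothVector v₀ := hκ.isSmooth v₀
  let Φ : V →ₗ[ℂ] V :=
    { toFun := compactLift κ K₀ lam κ v₀
      map_add' := compactLift_add hK₀o hK₀c hsc hZ hlam hy
      map_smul' := compactLift_smul hK₀o hK₀c hsc hZ hlam hy }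
  obtain ⟨c, hc⟩ := hκ.exists_eq_smul_id hK₀o hK₀c Φ fun g => LinearMap.ext fun v =>
    compactLift_apply hK₀o hK₀c hsc hZ hlam hy g v
  exact ⟨c, fun v => LinearMap.congr_fun hc v⟩

/-- **Non-vanishing of the Schur scalar for `λ = B(·, v₀)`.** With `λ₁ ∈ Ṽ`, `λ₁ v₀ ≠ 0` and
`λ = B(·, v₀)`: `λ(S_{λ,v₀} v₀) = ∫ |B(κ(h) v₀, v₀)|² dh ≠ 0`, so the scalar `c` with
`S_{λ,v₀} = c · id` is non-zero (`c B(v₀,v₀) ≠ 0`). [folklore] -/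
theorem compactLift_self_ne_zero {lam₁ : Module.Dual ℂ V} (hlam₁ : lam₁ ∈ κ.contragredient) {v₀ : V}
    (hv₀ : lam₁ v₀ ≠ 0) :
    formDual hK₀o hK₀c hsc hZ hlam₁ v₀ (compactLift κ K₀ (formDual hK₀o hK₀c hsc hZ hlam₁ v₀) κ v₀ v₀) ≠ 0 := by
  set lam := formDual hK₀o hK₀c hsc hZ hlam₁ v₀ with hlamdef
  have hlam : lam ∈ κ.contragredient := formDual_mem_contragredient hK₀o hK₀c hsc hZ hlam₁ hκ.isSmooth v₀
  have hy : κ.IsSmoothVector v₀ := hκ.isSmooth v₀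
  have had := isAdapted_liftFun_liftLevel (σ := κ) hK₀o hK₀c hsc hZ hlam hy v₀
  rw [compactLift, had.map_lcInt lam]
  -- the integrand is `|B(κ(h) v₀, v₀)|²`
  have hint : (lam : V →ₗ[ℂ] ℂ) ∘ liftFun κ lam κ v₀ v₀ =
      fun h => (Complex.normSq (κ.compactForm K₀ lam₁ (κ h v₀) v₀) : ℂ) := by
    funext h
    simp only [Function.comp_apply, liftFun, coeffFun_apply, map_smul, smul_eq_mul, hlamdef, formDual_apply]
    rw [← Complex.mul_conj, mul_comm]
    congr 1
    -- `B(κ(h⁻¹) v₀, v₀) = B(v₀, κ(h) v₀) = conj B(κ(h) v₀, v₀)`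
    rw [← compactForm_conj_symm hK₀o hK₀c hsc hZ hlam₁,
      ← compactForm_apply_apply hK₀o hK₀c hsc hZ hlam₁ h (κ h⁻¹ v₀) v₀, ← Module.End.mul_apply, ← map_mul,
      mul_inv_cancel, map_one, Module.End.one_apply]
  rw [hint]
  refine (IsAdapted.lcInt_ne_zero (hint ▸ had.map (lam : V →ₗ[ℂ] ℂ)) (fun g => ?_) (fun g => ?_) ?_)
  · rw [Complex.ofReal_re]; exact Complex.normSq_nonneg _
  · rw [Complex.ofReal_im]
  · rw [map_one, Module.End.one_apply, Ne, Complex.ofReal_eq_zero, Complex.normSq_eq_zero]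
    exact compactForm_self_ne_zero hK₀o hK₀c hsc hZ hlam₁ hv₀

/-- **Compact irreducible representations are projective** (Bernstein–Zelevinsky 1976,
Thm. 2.44; Bernstein–Zelevinsky 1977, Thm. 2.4 (b); Casselman 1995, Thm. 5.4.1). Let `G` have a
compact open subgroup `K₀` and compact centre, and let `κ` be an irreducible admissible
representation of `G` over `ℂ` whose smooth matrix coefficients are compactly supported
(`IsSupercuspidal`). Then every surjective intertwining map `q : σ → κ` from a smooth
representation `σ` has an equivariant section `s : κ → σ`, `q ∘ s = id`.
[cite: BernsteinZelevinsky1976, Thm. 2.44] -/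
theorem exists_section_of_isSupercuspidal [κ.IsIrreducible] {Y : Type*} [AddCommGroup Y] [Module ℂ Y]
    {σ : Representation ℂ G Y} (hσ : σ.IsSmooth) (q : σ.IntertwiningMap κ)
    (hq : Function.Surjective q) : ∃ s : κ.IntertwiningMap σ, ∀ v, q (s v) = v := by
  -- a non-zero vector and a separating smooth functional
  haveI : Nontrivial V := IsIrreducible.nontrivial κ
  obtain ⟨v₀, hv₀0⟩ := exists_ne (0 : V)
  set K : Subgroup G := K₀ ⊓ κ.stabilizerSubgroup v₀ with hKdef
  have hKo : IsOpen (K : Set G) := hK₀o.inter (hκ.isSmooth v₀)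
  have hKc : IsCompact (K : Set G) := hK₀c.of_isClosed_subset (Subgroup.isClosed_of_isOpen _ hKo) fun g hg => hg.1
  have hvK : v₀ ∈ κ.fixedPoints K := (κ.mem_fixedPoints K v₀).2 fun g hg => hg.2
  obtain ⟨lam₁, hlam₁, -, hv₀⟩ :=
    hκ.isSmooth.exists_mem_contragredient_apply_ne_zero_of_mem_fixedPoints hKo hKc hvK hv₀0
  -- the functional `λ = B(·, v₀)` and the Schur scalar
  set lam := formDual hK₀o hK₀c hsc hZ hlam₁ v₀ with hlamdef
  have hlam : lam ∈ κ.contragredient := formDual_mem_contragredient hK₀o hK₀c hsc hZ hlam₁ hκ.isSmooth v₀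
  obtain ⟨c, hc⟩ := exists_compactLift_self_eq_smul hK₀o hK₀c hsc hZ hκ hlam v₀
  have hc0 : c ≠ 0 := by
    intro h0
    apply compactLift_self_ne_zero hK₀o hK₀c hsc hZ hκ hlam₁ hv₀
    rw [← hlamdef, hc v₀, h0, zero_smul, map_zero]
  -- the section
  obtain ⟨y, hy⟩ := hq v₀
  have hys : σ.IsSmoothVector y := hσ y
  let s₀ : V →ₗ[ℂ] Y :=
    { toFun := compactLift κ K₀ lam σ y
      map_add' := compactLift_add hK₀o hK₀c hsc hZ hlam hys
      map_smul' := compactLift_smul hK₀o hK₀c hsc hZ hlam hys }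
  let s₁ : κ.IntertwiningMap σ := s₀.intertwiningMap_of_isIntertwiningMap _ _ fun g v =>
    compactLift_apply hK₀o hK₀c hsc hZ hlam hys g v
  refine ⟨c⁻¹ • s₁, fun v => ?_⟩
  rw [IntertwiningMap.smul_apply, map_smul]
  change c⁻¹ • q (compactLift κ K₀ lam σ y v) = v
  rw [map_compactLift hK₀o hK₀c hsc hZ hlam q hys v, hy, hc v, smul_smul, inv_mul_cancel₀ hc0, one_smul]

end Projective

end Representation
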